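import Summits.BirchSwinnertonDyer.BirchSwinnertonDyer.Theses.FrozenTwin
import Literature.NumberTheory.EllipticCurves.UnramifiedPrimeTwist

/-!
# Sketch — crux idea `level-one-bipartite` for `FrozenTwinBound` (stmt-BirchSwinnertonDyer-17173)

First-lemma signatures (elaboration check only; nothing is proved here):

* `Compatible T dlog` — the unramified prime twist `T` (a surjective everywhere-unramified
  character `χ : Γ_K → ZMod p`, tree notion `UnramifiedPrimeTwist`, Mazur–Rubin's `A_L`) is the one
  cut out by the class-group datum `(σ, dlog)` of the crux: `χ(Frob_v) = dlog [v] (mod p)` for every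
  finite place `v` (Artin reciprocity for `L ⊆ H_K`).
* `RankZeroLengthTwist` — the TRANSFER `C⁺` of the idea: Howard's one-sided bipartite bound
  (Kim 2024 Thm 5.16 at `n = 1`) run for the conjugate-self-dual twist `T_p E ⊗ χ` over
  `R = ℤ_p[ζ_p]/(π^k)` at conductor one: `S_χ ∉ 𝔓^{k+1} ⇒ Sel_{𝔓^∞}(A_χ/K)` is finite of order
  `≤ p^{2k}` (i.e. `length_𝓞 ≤ 2·v_𝔓(S_χ) ≤ 2k`).
* `FreezingDoubling` — the shared (with line `birth`) finite-level step: Mazur–Rubin freezing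
  `Sel_𝔓(A_χ) = Sel_p(E/K)` + the anti-invariant Cassels–Tate–Flach shadow form give
  `#Sel_p(E/ℚ) ≤ p^k` from `#Sel_{𝔓^∞}(A_χ/K) ≤ p^{2k}`.
* `ExistsCompatibleTwist` — class field theory: the degree-`p` subfield of the Hilbert class field
  attached to `𝔞 ↦ dlog 𝔞 (mod p)`.
-/

open scoped BigOperators
open NumberField IsDedekindDomain
open Literature.NumberTheory.EllipticCurves Literature.NumberTheory.GaloisRepresentations

namespace Summit.BirchSwinnertonDyer.BirchSwinnertonDyer.Cruxes.FrozenTwinBound.LevelOneBipartite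

/-- `χ_T(Frob_v) = dlog [v] (mod p)` at every finite place `v` of `K` (well defined: `T.char` is
trivial on inertia). -/
def Compatible {K : Type} [Field K] [NumberField K] {p : ℕ} [Fact p.Prime]
    (T : UnramifiedPrimeTwist K p) (dlog : ClassGroup (NumberField.RingOfIntegers K) → ℕ) : Prop :=
  ∀ (v : HeightOneSpectrum (NumberField.RingOfIntegers K))
    (𝔓 : Ideal (absIntegers (NumberField.RingOfIntegers K) K)), 𝔓 ∈ v.primesAbove →
    ∀ Φ : Field.absoluteGaloisGroup K, IsArithFrobAt (NumberField.RingOfIntegers K) Φ 𝔓 →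
      T.char Φ = Multiplicative.ofAdd
        ((dlog (ClassGroup.mk0 ⟨v.asIdeal, mem_nonZeroDivisors_of_ne_zero v.ne_bot⟩) : ZMod p))

/-- **C⁺ (RankZeroLengthTwist).** For every admissible frozen-twin datum (the hypotheses of the
crux verbatim), every unramified prime twist `T` compatible with `(σ, dlog)`, every `k`, every `p`-th
cyclotomic field `L` with primitive `ζ`: if the order-`p` class-group twist of the Gross period
`S_χ = Σ_𝔞 ζ^(dlog 𝔞) φ(x_𝔞)` does not lie in `(ζ - 1)^(k+1)`, then `Sel_{𝔓^∞}(A_χ/K)` is finite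
of order at most `p^(2k)`.  Intended proof: Howard's bipartite Euler-system bound
`λ₁ ∈ 𝔪^{length M₁} R` (Kim 2024, Thm 5.16, `n = 1`) for `(T_p E ⊗ χ)/π^k` over
`R = ℤ_p[ζ_p]/(π^k)`, classes = `χ`-components of conductor-one CM classes on the level-raised
Shimura curves `X_{N⁺, N⁻ℓ}`, `λ₁ = S_χ`; no `p`-adic `L`-function, no tower. -/
def RankZeroLengthTwist : Prop :=
  ∀ (V : WeierstrassCurve ℚ) [V.IsElliptic] [V.IsGloballyMinimal] (p : ℕ) [Fact p.Prime] (Nplus Nminus m : ℕ) (a b : ℚ) (O : Subring (QuaternionAlgebra ℚ a 0 b)) (K : Type) [Field K] [NumberField K] (ψ : K →ₐ[ℚ] QuaternionAlgebra ℚ a 0 b) (I : Submodule ℤ (QuaternionAlgebra ℚ a 0 b)) (φ : Submodule ℤ (QuaternionAlgebra ℚ a 0 b) → ℤ) (rep : ClassGroup (NumberField.RingOfIntegers K) → nonZeroDivisors (Ideal (NumberField.RingOfIntegers K))) (RI : Set (Submodule ℤ (QuaternionAlgebra ℚ a 0 b))) (σ : ClassGroup (NumberField.RingOfIntegers K)) (dlog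 : ClassGroup (NumberField.RingOfIntegers K) → ℕ), ((5 ≤ p ∧ V.HasGoodReductionAtPrime p ∧ ¬ (p : ℤ) ∣ V.frobeniusTrace p ∧ V.HasSurjectiveModNGaloisRep p ∧ (∀ q : ℕ, q.Prime → q ∣ V.conductorNorm ℤ → ¬ (p : ℤ) ∣ (q : ℤ) ^ 2 - 1) ∧ (∀ (q : ℕ) (_ : Fact q.Prime), V.HasMultiplicativeReductionAtPrime q → ¬ (p : ℤ) ∣ padicValRat q V.j)) ∧ (Module.finrank ℚ K = 2 ∧ NumberField.IsTotallyComplex K ∧ NumberField.discr K < -4 ∧ Int.gcd (NumberField.discr K) (V.conductorNorm ℤ * p) = 1) ∧ (V.conductorNorm ℤ = Nplus * Nminus ∧ Nat.Coprime Nplus Nminus ∧ Squarefree Nminus ∧ Odd Nminus.primeFactors.card ∧ (∀ q : ℕ, q.Prime → q ∣ Nplus → ((Ideal.span {(q : ℤ)}).primesOver (NumberField.RingOfIntegers K)).ncard = 2) ∧ (∀ q : ℕ, q.Prime → q ∣ Nminus → ((Ideal.span {(q : ℤ)}).primesOver (NumberField.RingOfIntegers K)).ncard = 1)) ∧ (a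 < 0 ∧ b < 0 ∧ (∀ (q : ℕ) [Fact q.Prime], (∀ x : QuaternionAlgebra ℚ_[q] (a : ℚ_[q]) 0 (b : ℚ_[q]), x ≠ 0 → IsUnit x) ↔ q ∣ Nminus)) ∧ (∃ O₁ O₂ : Subring (QuaternionAlgebra ℚ a 0 b), (∀ S : Subring (QuaternionAlgebra ℚ a 0 b), (S = O₁ ∨ S = O₂) → (S.toAddSubgroup.FG ∧ (∀ d : QuaternionAlgebra ℚ a 0 b, ∃ n : ℤ, n ≠ 0 ∧ n • d ∈ S) ∧ ∀ S' : Subring (QuaternionAlgebra ℚ a 0 b), S'.toAddSubgroup.FG → S ≤ S' → S' = S)) ∧ O = O₁ ⊓ O₂ ∧ O.toAddSubgroup.relIndex O₁.toAddSubgroup = Nplus) ∧ (∀ J : Submodule ℤ (QuaternionAlgebra ℚ a 0 b), J ∈ RI ↔ (J.FG ∧ (∀ d : QuaternionAlgebra ℚ a 0 b, ∃ n : ℤ, n ≠ 0 ∧ n • d ∈ J) ∧ (∀ x : QuaternionAlgebra ℚ a 0 b, (∀ y ∈ J, y * x ∈ J) ↔ x ∈ O) ∧ (∃ J' : Submodule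 ℤ (QuaternionAlgebra ℚ a 0 b), (∀ x : QuaternionAlgebra ℚ a 0 b, x ∈ J * J' ↔ ∀ y ∈ J, x * y ∈ J) ∧ (∀ x : QuaternionAlgebra ℚ a 0 b, x ∈ J' * J ↔ x ∈ O)))) ∧ ((∀ J ∈ RI, ∀ β : QuaternionAlgebra ℚ a 0 b, IsUnit β → φ (J.map (AddMonoidHom.mulLeft β).toIntLinearMap) = φ J) ∧ (∀ q : ℕ, q.Prime → ¬ q ∣ V.conductorNorm ℤ → ∀ J ∈ RI, ∑ᶠ J' ∈ {J' : Submodule ℤ (QuaternionAlgebra ℚ a 0 b) | J' ≤ J ∧ J'.toAddSubgroup.relIndex J.toAddSubgroup = q ^ 2 ∧ ∀ y ∈ J', ∀ x ∈ O, y * x ∈ J'}, φ J' = (V.frobeniusTrace q : ℤ) * φ J) ∧ (∃ J ∈ RI, ¬ (p : ℤ) ∣ φ J)) ∧ (I ∈ RI ∧ (∀ x : NumberField.RingOfIntegers K, ∀ y ∈ I, ψ (x : K) * y ∈ I) ∧ (∀ x : K, (∀ y ∈ I, ψ x * y ∈ I) → ∃ z : NumberField.RingOfIntegers K, (z : K)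 = x) ∧ (∀ 𝔞 : ClassGroup (NumberField.RingOfIntegers K), ClassGroup.mk0 (rep 𝔞) = 𝔞) ∧ (∀ 𝔞 : ClassGroup (NumberField.RingOfIntegers K), Submodule.span ℤ ((fun x : NumberField.RingOfIntegers K => ψ (x : K)) '' ((rep 𝔞 : nonZeroDivisors (Ideal (NumberField.RingOfIntegers K))) : Ideal (NumberField.RingOfIntegers K))) * I ∈ RI)) ∧ (1 ≤ m ∧ orderOf σ = p ^ m ∧ ¬ p ^ (m + 1) ∣ Fintype.card (ClassGroup (NumberField.RingOfIntegers K)) ∧ (∀ 𝔞 : ClassGroup (NumberField.RingOfIntegers K), dlog 𝔞 < p ^ m ∧ Nat.Coprime (orderOf (𝔞 * (σ ^ dlog 𝔞)⁻¹)) p))) →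
    ∀ (T : UnramifiedPrimeTwist K p), Compatible T dlog →
    ∀ (k : ℕ) (L : Type) [Field L] [CharZero L] [IsCyclotomicExtension {p} ℚ L]
      (ζ : NumberField.RingOfIntegers L), IsPrimitiveRoot ζ p →
      (∑ 𝔞 : ClassGroup (NumberField.RingOfIntegers K), ζ ^ (dlog 𝔞) * ((φ (Submodule.span ℤ ((fun x : NumberField.RingOfIntegers K => ψ (x : K)) '' ((rep 𝔞 : nonZeroDivisors (Ideal (NumberField.RingOfIntegers K))) : Ideal (NumberField.RingOfIntegers K))) * I) : ℤ) : NumberField.RingOfIntegers L)) ∉ (Ideal.span {ζ - 1} : Ideal (NumberField.RingOfIntegers L)) ^ (k + 1) →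
      Finite ↥(T.selmerGroupPInfty (V.baseChange K)) ∧
        Nat.card ↥(T.selmerGroupPInfty (V.baseChange K)) ≤ p ^ (2 * k)

/-- **FreezingDoubling** (shared with line `birth`, there folded into `stub_twistedPeriodSelmerBound`):
Mazur–Rubin Prop. 1.3 / Cor. 4.6 freezing `Sel_𝔓(A_χ/K) = Sel_p(E/K) = Sel_p(E/ℚ) ⊕ Sel_p(E^D/ℚ)` under
the side conditions, and the anti-invariant Cassels–Tate–Flach shadow form on `Sel_{𝔓^∞}(A_χ/K)`
(`length ≥ 2·max(s⁺, s⁻)`): an order bound `p^(2k)` on the twin's `𝔓^∞`-Selmer group caps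
`#Sel_p(E/ℚ) ≤ p^k`. -/
def FreezingDoubling : Prop :=
  ∀ (V : WeierstrassCurve ℚ) [V.IsElliptic] [V.IsGloballyMinimal] (p : ℕ) [Fact p.Prime] (Nplus Nminus m : ℕ) (a b : ℚ) (O : Subring (QuaternionAlgebra ℚ a 0 b)) (K : Type) [Field K] [NumberField K] (ψ : K →ₐ[ℚ] QuaternionAlgebra ℚ a 0 b) (I : Submodule ℤ (QuaternionAlgebra ℚ a 0 b)) (φ : Submodule ℤ (QuaternionAlgebra ℚ a 0 b) → ℤ) (rep : ClassGroup (NumberField.RingOfIntegers K) → nonZeroDivisors (Ideal (NumberField.RingOfIntegers K))) (RI : Set (Submodule ℤ (QuaternionAlgebra ℚ a 0 b))) (σ : ClassGroup (NumberField.RingOfIntegers K)) (dlog : ClassGroup (NumberField.RingOfIntegers K) → ℕ), ((5 ≤ p ∧ V.HasGoodReductionAtPrime p ∧ ¬ (p : ℤ) ∣ V.frobeniusTrace p ∧ V.HasSurjectiveModNGaloisRep p ∧ (∀ q : ℕ, q.Prime → q ∣ V.conductorNorm ℤ → ¬ (p : ℤ) ∣ (q : ℤ) ^ 2 - 1) ∧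 (∀ (q : ℕ) (_ : Fact q.Prime), V.HasMultiplicativeReductionAtPrime q → ¬ (p : ℤ) ∣ padicValRat q V.j)) ∧ (Module.finrank ℚ K = 2 ∧ NumberField.IsTotallyComplex K ∧ NumberField.discr K < -4 ∧ Int.gcd (NumberField.discr K) (V.conductorNorm ℤ * p) = 1) ∧ (V.conductorNorm ℤ = Nplus * Nminus ∧ Nat.Coprime Nplus Nminus ∧ Squarefree Nminus ∧ Odd Nminus.primeFactors.card ∧ (∀ q : ℕ, q.Prime → q ∣ Nplus → ((Ideal.span {(q : ℤ)}).primesOver (NumberField.RingOfIntegers K)).ncard = 2) ∧ (∀ q : ℕ, q.Prime → q ∣ Nminus → ((Ideal.span {(q : ℤ)}).primesOver (NumberField.RingOfIntegers K)).ncard = 1)) ∧ (a < 0 ∧ b < 0 ∧ (∀ (q : ℕ) [Fact q.Prime], (∀ x : QuaternionAlgebra ℚ_[q] (a : ℚ_[q]) 0 (b : ℚ_[q]), x ≠ 0 → IsUnit x) ↔ q ∣ Nminus)) ∧ (∃ O₁ O₂ : Subring (QuaternionAlgebra ℚ a 0 b), (∀ S : Subring (QuaternionAlgebra ℚ a 0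 b), (S = O₁ ∨ S = O₂) → (S.toAddSubgroup.FG ∧ (∀ d : QuaternionAlgebra ℚ a 0 b, ∃ n : ℤ, n ≠ 0 ∧ n • d ∈ S) ∧ ∀ S' : Subring (QuaternionAlgebra ℚ a 0 b), S'.toAddSubgroup.FG → S ≤ S' → S' = S)) ∧ O = O₁ ⊓ O₂ ∧ O.toAddSubgroup.relIndex O₁.toAddSubgroup = Nplus) ∧ (∀ J : Submodule ℤ (QuaternionAlgebra ℚ a 0 b), J ∈ RI ↔ (J.FG ∧ (∀ d : QuaternionAlgebra ℚ a 0 b, ∃ n : ℤ, n ≠ 0 ∧ n • d ∈ J) ∧ (∀ x : QuaternionAlgebra ℚ a 0 b, (∀ y ∈ J, y * x ∈ J) ↔ x ∈ O) ∧ (∃ J' : Submodule ℤ (QuaternionAlgebra ℚ a 0 b), (∀ x : QuaternionAlgebra ℚ a 0 b, x ∈ J * J' ↔ ∀ y ∈ J, x * y ∈ J) ∧ (∀ x : QuaternionAlgebra ℚ a 0 b, x ∈ J' * J ↔ x ∈ O)))) ∧ ((∀ J ∈ RI, ∀ β : QuaternionAlgebra ℚ a 0 b, IsUnit β → φ (J.map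 (AddMonoidHom.mulLeft β).toIntLinearMap) = φ J) ∧ (∀ q : ℕ, q.Prime → ¬ q ∣ V.conductorNorm ℤ → ∀ J ∈ RI, ∑ᶠ J' ∈ {J' : Submodule ℤ (QuaternionAlgebra ℚ a 0 b) | J' ≤ J ∧ J'.toAddSubgroup.relIndex J.toAddSubgroup = q ^ 2 ∧ ∀ y ∈ J', ∀ x ∈ O, y * x ∈ J'}, φ J' = (V.frobeniusTrace q : ℤ) * φ J) ∧ (∃ J ∈ RI, ¬ (p : ℤ) ∣ φ J)) ∧ (I ∈ RI ∧ (∀ x : NumberField.RingOfIntegers K, ∀ y ∈ I, ψ (x : K) * y ∈ I) ∧ (∀ x : K, (∀ y ∈ I, ψ x * y ∈ I) → ∃ z : NumberField.RingOfIntegers K, (z : K) = x) ∧ (∀ 𝔞 : ClassGroup (NumberField.RingOfIntegers K), ClassGroup.mk0 (rep 𝔞) = 𝔞) ∧ (∀ 𝔞 : ClassGroup (NumberField.RingOfIntegers K), Submodule.span ℤ ((fun x : NumberField.RingOfIntegers K => ψ (x : K)) '' ((rep 𝔞 : nonZeroDivisors (Ideal (NumberField.RingOfIntegers K))) : Ideal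 (NumberField.RingOfIntegers K))) * I ∈ RI)) ∧ (1 ≤ m ∧ orderOf σ = p ^ m ∧ ¬ p ^ (m + 1) ∣ Fintype.card (ClassGroup (NumberField.RingOfIntegers K)) ∧ (∀ 𝔞 : ClassGroup (NumberField.RingOfIntegers K), dlog 𝔞 < p ^ m ∧ Nat.Coprime (orderOf (𝔞 * (σ ^ dlog 𝔞)⁻¹)) p))) →
    ∀ (T : UnramifiedPrimeTwist K p), Compatible T dlog → ∀ (k : ℕ),
      Finite ↥(T.selmerGroupPInfty (V.baseChange K)) →
      Nat.card ↥(T.selmerGroupPInfty (V.baseChange K)) ≤ p ^ (2 * k) →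
      Finite ↥(V.selmerGroup (p : ℤ)) ∧ Nat.card ↥(V.selmerGroup (p : ℤ)) ≤ p ^ k

/-- **ExistsCompatibleTwist** (class field theory): the subfield of the Hilbert class field of `K`
fixed by the kernel of `𝔞 ↦ dlog 𝔞 (mod p)` gives an everywhere-unramified, totally split at `∞`,
surjective `χ : Γ_K → ZMod p` with `χ(Frob_v) = dlog [v]`. -/
def ExistsCompatibleTwist : Prop :=
  ∀ (V : WeierstrassCurve ℚ) [V.IsElliptic] [V.IsGloballyMinimal] (p : ℕ) [Fact p.Prime] (Nplus Nminus m : ℕ) (a b : ℚ) (O : Subring (QuaternionAlgebra ℚ a 0 b)) (K : Type) [Field K] [NumberField K] (ψ : K →ₐ[ℚ] QuaternionAlgebra ℚ a 0 b) (I : Submodule ℤ (QuaternionAlgebra ℚ a 0 b)) (φ : Submodule ℤ (QuaternionAlgebra ℚ a 0 b) → ℤ) (rep : ClassGroup (NumberField.RingOfIntegers K) → nonZeroDivisors (Ideal (NumberField.RingOfIntegers K))) (RI : Set (Submodule ℤ (QuaternionAlgebra ℚ a 0 b))) (σ : ClassGroup (NumberField.RingOfIntegers K)) (dlog : ClassGroup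 (NumberField.RingOfIntegers K) → ℕ), ((5 ≤ p ∧ V.HasGoodReductionAtPrime p ∧ ¬ (p : ℤ) ∣ V.frobeniusTrace p ∧ V.HasSurjectiveModNGaloisRep p ∧ (∀ q : ℕ, q.Prime → q ∣ V.conductorNorm ℤ → ¬ (p : ℤ) ∣ (q : ℤ) ^ 2 - 1) ∧ (∀ (q : ℕ) (_ : Fact q.Prime), V.HasMultiplicativeReductionAtPrime q → ¬ (p : ℤ) ∣ padicValRat q V.j)) ∧ (Module.finrank ℚ K = 2 ∧ NumberField.IsTotallyComplex K ∧ NumberField.discr K < -4 ∧ Int.gcd (NumberField.discr K) (V.conductorNorm ℤ * p) = 1) ∧ (V.conductorNorm ℤ = Nplus * Nminus ∧ Nat.Coprime Nplus Nminus ∧ Squarefree Nminus ∧ Odd Nminus.primeFactors.card ∧ (∀ q : ℕ, q.Prime → q ∣ Nplus → ((Ideal.span {(q : ℤ)}).primesOver (NumberField.RingOfIntegers K)).ncard = 2) ∧ (∀ q : ℕ, q.Prime → q ∣ Nminus → ((Ideal.span {(q : ℤ)}).primesOver (NumberField.RingOfIntegers K)).ncard = 1)) ∧ (a < 0 ∧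 b < 0 ∧ (∀ (q : ℕ) [Fact q.Prime], (∀ x : QuaternionAlgebra ℚ_[q] (a : ℚ_[q]) 0 (b : ℚ_[q]), x ≠ 0 → IsUnit x) ↔ q ∣ Nminus)) ∧ (∃ O₁ O₂ : Subring (QuaternionAlgebra ℚ a 0 b), (∀ S : Subring (QuaternionAlgebra ℚ a 0 b), (S = O₁ ∨ S = O₂) → (S.toAddSubgroup.FG ∧ (∀ d : QuaternionAlgebra ℚ a 0 b, ∃ n : ℤ, n ≠ 0 ∧ n • d ∈ S) ∧ ∀ S' : Subring (QuaternionAlgebra ℚ a 0 b), S'.toAddSubgroup.FG → S ≤ S' → S' = S)) ∧ O = O₁ ⊓ O₂ ∧ O.toAddSubgroup.relIndex O₁.toAddSubgroup = Nplus) ∧ (∀ J : Submodule ℤ (QuaternionAlgebra ℚ a 0 b), J ∈ RI ↔ (J.FG ∧ (∀ d : QuaternionAlgebra ℚ a 0 b, ∃ n : ℤ, n ≠ 0 ∧ n • d ∈ J) ∧ (∀ x : QuaternionAlgebra ℚ a 0 b, (∀ y ∈ J, y * x ∈ J) ↔ x ∈ O) ∧ (∃ J' : Submodule ℤ (QuaternionAlgebra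 ℚ a 0 b), (∀ x : QuaternionAlgebra ℚ a 0 b, x ∈ J * J' ↔ ∀ y ∈ J, x * y ∈ J) ∧ (∀ x : QuaternionAlgebra ℚ a 0 b, x ∈ J' * J ↔ x ∈ O)))) ∧ ((∀ J ∈ RI, ∀ β : QuaternionAlgebra ℚ a 0 b, IsUnit β → φ (J.map (AddMonoidHom.mulLeft β).toIntLinearMap) = φ J) ∧ (∀ q : ℕ, q.Prime → ¬ q ∣ V.conductorNorm ℤ → ∀ J ∈ RI, ∑ᶠ J' ∈ {J' : Submodule ℤ (QuaternionAlgebra ℚ a 0 b) | J' ≤ J ∧ J'.toAddSubgroup.relIndex J.toAddSubgroup = q ^ 2 ∧ ∀ y ∈ J', ∀ x ∈ O, y * x ∈ J'}, φ J' = (V.frobeniusTrace q : ℤ) * φ J) ∧ (∃ J ∈ RI, ¬ (p : ℤ) ∣ φ J)) ∧ (I ∈ RI ∧ (∀ x : NumberField.RingOfIntegers K, ∀ y ∈ I, ψ (x : K) * y ∈ I) ∧ (∀ x : K, (∀ y ∈ I, ψ x * y ∈ I) → ∃ z : NumberField.RingOfIntegers K, (z : K) = x) ∧ (∀ 𝔞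 : ClassGroup (NumberField.RingOfIntegers K), ClassGroup.mk0 (rep 𝔞) = 𝔞) ∧ (∀ 𝔞 : ClassGroup (NumberField.RingOfIntegers K), Submodule.span ℤ ((fun x : NumberField.RingOfIntegers K => ψ (x : K)) '' ((rep 𝔞 : nonZeroDivisors (Ideal (NumberField.RingOfIntegers K))) : Ideal (NumberField.RingOfIntegers K))) * I ∈ RI)) ∧ (1 ≤ m ∧ orderOf σ = p ^ m ∧ ¬ p ^ (m + 1) ∣ Fintype.card (ClassGroup (NumberField.RingOfIntegers K)) ∧ (∀ 𝔞 : ClassGroup (NumberField.RingOfIntegers K), dlog 𝔞 < p ^ m ∧ Nat.Coprime (orderOf (𝔞 * (σ ^ dlog 𝔞)⁻¹)) p))) →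
    ∃ T : UnramifiedPrimeTwist K p, Compatible T dlog

/-- **Composition check (real proof).** The three statements `ExistsCompatibleTwist`,
`RankZeroLengthTwist` (= C⁺) and `FreezingDoubling` together give, verbatim, the statement of line
`birth`'s load-bearing stub `stub_twistedPeriodSelmerBound` — so the idea is a typed three-way SPLIT of
that stub whose middle piece is Howard's bound for the twist; with `birth`'s `stub_momentValuation` and
`stub_selmerCorank_le_of_card_selmerGroup` it reaches the crux through `birth`'s sorry-free assembly. -/
theorem twistedPeriodSelmerBound_of (h2 : ExistsCompatibleTwist) (h3 : RankZeroLengthTwist)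
    (h4 : FreezingDoubling) :
    ∀ (V : WeierstrassCurve ℚ) [V.IsElliptic] [V.IsGloballyMinimal] (p : ℕ) [Fact p.Prime] (Nplus Nminus m : ℕ) (a b : ℚ) (O : Subring (QuaternionAlgebra ℚ a 0 b)) (K : Type) [Field K] [NumberField K] (ψ : K →ₐ[ℚ] QuaternionAlgebra ℚ a 0 b) (I : Submodule ℤ (QuaternionAlgebra ℚ a 0 b)) (φ : Submodule ℤ (QuaternionAlgebra ℚ a 0 b) → ℤ) (rep : ClassGroup (NumberField.RingOfIntegers K) → nonZeroDivisors (Ideal (NumberField.RingOfIntegers K))) (RI : Set (Submodule ℤ (QuaternionAlgebra ℚ a 0 b))) (σ : ClassGroup (NumberField.RingOfIntegers K)) (dlog : ClassGroup (NumberField.RingOfIntegers K) → ℕ), ((5 ≤ p ∧ V.HasGoodReductionAtPrime p ∧ ¬ (p : ℤ) ∣ V.frobeniusTrace p ∧ V.HasSurjectiveModNGaloisRep p ∧ (∀ q : ℕ, q.Prime → q ∣ V.conductorNorm ℤ → ¬ (p : ℤ) ∣ (q : ℤ) ^ 2 - 1) ∧ (∀ (q : ℕ) (_ : Fact q.Prime),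 V.HasMultiplicativeReductionAtPrime q → ¬ (p : ℤ) ∣ padicValRat q V.j)) ∧ (Module.finrank ℚ K = 2 ∧ NumberField.IsTotallyComplex K ∧ NumberField.discr K < -4 ∧ Int.gcd (NumberField.discr K) (V.conductorNorm ℤ * p) = 1) ∧ (V.conductorNorm ℤ = Nplus * Nminus ∧ Nat.Coprime Nplus Nminus ∧ Squarefree Nminus ∧ Odd Nminus.primeFactors.card ∧ (∀ q : ℕ, q.Prime → q ∣ Nplus → ((Ideal.span {(q : ℤ)}).primesOver (NumberField.RingOfIntegers K)).ncard = 2) ∧ (∀ q : ℕ, q.Prime → q ∣ Nminus → ((Ideal.span {(q : ℤ)}).primesOver (NumberField.RingOfIntegers K)).ncard = 1)) ∧ (a < 0 ∧ b < 0 ∧ (∀ (q : ℕ) [Fact q.Prime], (∀ x : QuaternionAlgebra ℚ_[q] (a : ℚ_[q]) 0 (b : ℚ_[q]), x ≠ 0 → IsUnit x) ↔ q ∣ Nminus)) ∧ (∃ O₁ O₂ : Subring (QuaternionAlgebra ℚ a 0 b), (∀ S : Subring (QuaternionAlgebra ℚ a 0 b), (S = O₁ ∨ S = O₂) → (S.toAddSubgroup.FG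 ∧ (∀ d : QuaternionAlgebra ℚ a 0 b, ∃ n : ℤ, n ≠ 0 ∧ n • d ∈ S) ∧ ∀ S' : Subring (QuaternionAlgebra ℚ a 0 b), S'.toAddSubgroup.FG → S ≤ S' → S' = S)) ∧ O = O₁ ⊓ O₂ ∧ O.toAddSubgroup.relIndex O₁.toAddSubgroup = Nplus) ∧ (∀ J : Submodule ℤ (QuaternionAlgebra ℚ a 0 b), J ∈ RI ↔ (J.FG ∧ (∀ d : QuaternionAlgebra ℚ a 0 b, ∃ n : ℤ, n ≠ 0 ∧ n • d ∈ J) ∧ (∀ x : QuaternionAlgebra ℚ a 0 b, (∀ y ∈ J, y * x ∈ J) ↔ x ∈ O) ∧ (∃ J' : Submodule ℤ (QuaternionAlgebra ℚ a 0 b), (∀ x : QuaternionAlgebra ℚ a 0 b, x ∈ J * J' ↔ ∀ y ∈ J, x * y ∈ J) ∧ (∀ x : QuaternionAlgebra ℚ a 0 b, x ∈ J' * J ↔ x ∈ O)))) ∧ ((∀ J ∈ RI, ∀ β : QuaternionAlgebra ℚ a 0 b, IsUnit β → φ (J.map (AddMonoidHom.mulLeft β).toIntLinearMap) = φ J) ∧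 (∀ q : ℕ, q.Prime → ¬ q ∣ V.conductorNorm ℤ → ∀ J ∈ RI, ∑ᶠ J' ∈ {J' : Submodule ℤ (QuaternionAlgebra ℚ a 0 b) | J' ≤ J ∧ J'.toAddSubgroup.relIndex J.toAddSubgroup = q ^ 2 ∧ ∀ y ∈ J', ∀ x ∈ O, y * x ∈ J'}, φ J' = (V.frobeniusTrace q : ℤ) * φ J) ∧ (∃ J ∈ RI, ¬ (p : ℤ) ∣ φ J)) ∧ (I ∈ RI ∧ (∀ x : NumberField.RingOfIntegers K, ∀ y ∈ I, ψ (x : K) * y ∈ I) ∧ (∀ x : K, (∀ y ∈ I, ψ x * y ∈ I) → ∃ z : NumberField.RingOfIntegers K, (z : K) = x) ∧ (∀ 𝔞 : ClassGroup (NumberField.RingOfIntegers K), ClassGroup.mk0 (rep 𝔞) = 𝔞) ∧ (∀ 𝔞 : ClassGroup (NumberField.RingOfIntegers K), Submodule.span ℤ ((fun x : NumberField.RingOfIntegers K => ψ (x : K)) '' ((rep 𝔞 : nonZeroDivisors (Ideal (NumberField.RingOfIntegers K))) : Ideal (NumberField.RingOfIntegers K))) * I ∈ RI)) ∧ (1 ≤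 m ∧ orderOf σ = p ^ m ∧ ¬ p ^ (m + 1) ∣ Fintype.card (ClassGroup (NumberField.RingOfIntegers K)) ∧ (∀ 𝔞 : ClassGroup (NumberField.RingOfIntegers K), dlog 𝔞 < p ^ m ∧ Nat.Coprime (orderOf (𝔞 * (σ ^ dlog 𝔞)⁻¹)) p))) →
      ∀ (k : ℕ) (L : Type) [Field L] [CharZero L] [IsCyclotomicExtension {p} ℚ L]
        (ζ : NumberField.RingOfIntegers L), IsPrimitiveRoot ζ p →
        (∑ 𝔞 : ClassGroup (NumberField.RingOfIntegers K), ζ ^ (dlog 𝔞) * ((φ (Submodule.span ℤ ((fun x : NumberField.RingOfIntegers K => ψ (x : K)) '' ((rep 𝔞 : nonZeroDivisors (Ideal (NumberField.RingOfIntegers K))) : Ideal (NumberField.RingOfIntegers K))) * I) : ℤ) : NumberField.RingOfIntegers L)) ∉ (Ideal.span {ζ - 1} : Ideal (NumberField.RingOfIntegers L)) ^ (k + 1) →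
        Finite ↥(V.selmerGroup (p : ℤ)) ∧ Nat.card ↥(V.selmerGroup (p : ℤ)) ≤ p ^ k := by
  intro V _ _ p _ Nplus Nminus m a b O K _ _ ψ I φ rep RI σ dlog hH k L _ _ _ ζ hζ hS
  obtain ⟨T, hT⟩ := h2 V p Nplus Nminus m a b O K ψ I φ rep RI σ dlog hH
  obtain ⟨hfin, hcard⟩ := h3 V p Nplus Nminus m a b O K ψ I φ rep RI σ dlog hH T hT k L ζ hζ hS
  exact h4 V p Nplus Nminus m a b O K ψ I φ rep RI σ dlog hH T hT k hfin hcard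

end Summit.BirchSwinnertonDyer.BirchSwinnertonDyer.Cruxes.FrozenTwinBound.LevelOneBipartite
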